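import Summits.SmoothPoincare4.SmoothPoincare4.Theorems.DottedCircleRasmussenDcrGapHelperFriendsCarrierVkPartCDatum

/-!
# Helper `helper_friendsCarrier_Vk_partC` (V_k part C: the collar of the uninverted model disc exterior) —
# piece 2: the flow chart of the band, the thin shells, the tube neighbourhood of the disc
(item stmt-SmoothPoincare4-16128, route route-SmoothPoincare4-DottedCircleRasmussen)

Second piece of the port of the tree's `SliceDiscEndCollar.lean` to `M_k ⊂ ℝ⁴` (definitions in
`…VkPartCDatum`).  The elementary API of the collar datum `V : FriendsVk.CollarDatum k`:

* the flow chart of the band `B = {off the poles} ∩ {|G_k - 1| < 2ε}` (`helper_friendsCarrier_Vk_collarChart`):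
  clock `depth (Φ(s, a)) = s`, drop `drop (Φ(s, a)) = a`, `y = Φ(depth y, drop y)`, smoothness of `depth`
  and `drop`; `D_k` along the flow-out: `Φ(s, a) ∈ D_k ↔ s ≤ 0`;
* the thin shells `shell s = Φ((0, s) × M_k)`: open, off `D_k`, inside the compact `Φ([0, s] × M_k)`;
* the tube neighbourhood `N = G(D̊² × B(0,2))` of the open disc: open, off `D_k`, with the `C^∞` inverse
  chart `Ginv` (inverse function theorem) — the template's proofs, verbatim;
* the closed unit tube `ν(𝕊¹ × B̄(0,1)) ⊆ M_k` (compact, contains `K₁`) and the disc `Δ = g(𝔻²)` (compact;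
  its boundary circle is `K₁ ⊂ M_k ⊂ D_k`, so a tube point `G(x, w)`, `w ≠ 0`, is off `Δ`);
* `helper_friendsCarrier_Vk_partC_tube` — the registered summary (the tube neighbourhood of the open disc
  is open with a smooth inverse chart and misses `D_k`; the thin shell is open and misses `D_k`).

Everything is proved; no definitions, no named facts, no `sorry`.
References: Manolescu–Piccirillo (2023), §3.2 [ManolescuPiccirillo2023]; Kosinski (1993), Ch. VI §5 [Kosinski1993].
-/

-- the prescribed namespace `Summit.<P>.<Sub>.…` duplicates `SmoothPoincare4` (P = Sub)
set_option linter.dupNamespace false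
set_option linter.style.longLine false

noncomputable section

open scoped Manifold ContDiff Topology
open Function Set Metric
open Literature.Topology.FourManifolds Literature.Topology.FourManifolds.MMSW

namespace Summit.SmoothPoincare4.SmoothPoincare4.Theorems.DcrGap.MkFriends

namespace FriendsVk

namespace CollarDatum

variable {k : ℕ} (V : CollarDatum k)

/-! ### Constants -/

/-- `0 < s₁`. [folklore] -/
theorem width_pos : 0 < V.s₁ := V.s₀_pos.trans V.s₀_lt

/-- `s₀ < 2ε`. [folklore] -/
theorem s₀_lt_two : V.s₀ < 2 * V.ε := V.s₀_lt.trans V.s₁_lt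

/-- `2ε ≤ 1/2`. [folklore] -/
theorem two_le_half : 2 * V.ε ≤ 1 / 2 := by linarith [V.ε_le]

/-- `s₁ < 1`. [folklore] -/
theorem width_lt_one : V.s₁ < 1 := by linarith [V.s₁_lt, V.two_le_half]

/-- `s₀ < 1`. [folklore] -/
theorem depth₀_lt_one : V.s₀ < 1 := V.s₀_lt.trans V.width_lt_one

/-! ### The flow -/

/-- `Φ(-s, Φ(s, x)) = x`. [folklore] -/
theorem Φ_neg_Φ (s : ℝ) (x : EuclideanSpace ℝ (Fin 4)) : V.Φ (-s, V.Φ (s, x)) = x := by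
  rw [V.Φ_add, neg_add_cancel, V.Φ_zero]

/-- `Φ(s, Φ(-s, x)) = x`. [folklore] -/
theorem Φ_Φ_neg (s : ℝ) (x : EuclideanSpace ℝ (Fin 4)) : V.Φ (s, V.Φ (-s, x)) = x := by
  rw [V.Φ_add, add_neg_cancel, V.Φ_zero]

/-- Each time map of the flow is injective. [folklore] -/
theorem Φ_injective (s : ℝ) : Injective fun x => V.Φ (s, x) := fun x y h => by
  simpa [V.Φ_neg_Φ] using congrArg (fun z => V.Φ (-s, z)) h

/-- The flow is continuous. [folklore] -/
theorem continuous_Φ : Continuous V.Φ := V.contDiff_Φ.continuous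

/-! ### The flow chart of the band -/

/-- The band is open. [folklore] -/
theorem band_open : IsOpen V.band := FriendsCarrierVk.isOpen_band k V.ε

/-- The flow chart of the band (`helper_friendsCarrier_Vk_collarChart`). [folklore] -/
theorem chart :
    (∀ x ∈ modelBoundary k, ∀ s : ℝ, |s| < 2 * V.ε →
      (∀ j, 0 < holeTerm k j (V.Φ (s, x))) ∧ |levelFun k (V.Φ (s, x)) - 1| < 2 * V.ε) ∧
    (∀ y, (∀ j, 0 < holeTerm k j y) → |levelFun k y - 1| < 2 * V.ε →
      V.Φ (1 - levelFun k y, y) ∈ modelBoundary k ∧ V.Φ (levelFun k y - 1, V.Φ (1 - levelFun k y, y)) = y) ∧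
    (∀ x ∈ modelBoundary k, ∀ s : ℝ, |s| < 2 * V.ε → V.Φ (1 - levelFun k (V.Φ (s, x)), V.Φ (s, x)) = x) ∧
    (∀ x ∈ modelBoundary k, ∀ x' ∈ modelBoundary k, ∀ s s' : ℝ, |s| < 2 * V.ε → |s'| < 2 * V.ε →
      V.Φ (s, x) = V.Φ (s', x') → s = s' ∧ x = x') ∧
    ContDiffOn ℝ ∞ (levelFun k) {y : EuclideanSpace ℝ (Fin 4) | (∀ j : Fin k, 0 < holeTerm k j y) ∧ |levelFun k y - 1| < 2 * V.ε} ∧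
    ContDiffOn ℝ ∞ (fun y => V.Φ (1 - levelFun k y, y))
      {y : EuclideanSpace ℝ (Fin 4) | (∀ j : Fin k, 0 < holeTerm k j y) ∧ |levelFun k y - 1| < 2 * V.ε} :=
  FriendsCarrierVk.collarChart V.contDiff_Φ V.Φ_zero V.Φ_add V.clock V.band_mem

/-- **The clock**: `G_k(Φ(s, a)) = 1 + s`, i.e. `depth (Φ(s, a)) = s`, for `a ∈ M_k`, `|s| < 2ε`. [folklore] -/
theorem depth_Φ {a : EuclideanSpace ℝ (Fin 4)} (ha : a ∈ modelBoundary k) {s : ℝ} (hs : |s| < 2 * V.ε) : depth k (V.Φ (s, a)) = s := by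
  rw [depth, (V.clock a ha s hs.le).2, add_sub_cancel_left]

/-- The guard along the flow-out of `M_k`: `|z - c_j|² > 1/2`. [folklore] -/
theorem half_lt_holeTerm_Φ {a : EuclideanSpace ℝ (Fin 4)} (ha : a ∈ modelBoundary k) {s : ℝ} (hs : |s| < 2 * V.ε) (j : Fin k) :
    (1 : ℝ) / 2 < holeTerm k j (V.Φ (s, a)) := (V.clock a ha s hs.le).1 j

/-- Flow lines from `M_k` stay in the band for `|s| < 2ε`. [folklore] -/
theorem Φ_mem_band {a : EuclideanSpace ℝ (Fin 4)} (ha : a ∈ modelBoundary k) {s : ℝ} (hs : |s| < 2 * V.ε) : V.Φ (s, a) ∈ V.band :=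
  V.chart.1 a ha s hs

/-- **The drop** of `Φ(s, a)` is `a`. [folklore] -/
theorem drop_Φ {a : EuclideanSpace ℝ (Fin 4)} (ha : a ∈ modelBoundary k) {s : ℝ} (hs : |s| < 2 * V.ε) : V.drop (V.Φ (s, a)) = a :=
  V.chart.2.2.1 a ha s hs

/-- The drop of a band point lies on `M_k`. [folklore] -/
theorem drop_mem {y : EuclideanSpace ℝ (Fin 4)} (hy : y ∈ V.band) : V.drop y ∈ modelBoundary k := (V.chart.2.1 y hy.1 hy.2).1

/-- A band point is `Φ(depth y, drop y)`. [folklore] -/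
theorem Φ_depth_drop {y : EuclideanSpace ℝ (Fin 4)} (hy : y ∈ V.band) : V.Φ (depth k y, V.drop y) = y := (V.chart.2.1 y hy.1 hy.2).2

/-- The depth of a band point is `< 2ε` in absolute value. [folklore] -/
theorem abs_depth_lt {y : EuclideanSpace ℝ (Fin 4)} (hy : y ∈ V.band) : |depth k y| < 2 * V.ε := hy.2

/-- `G_k` is smooth on the band. [folklore] -/
theorem contDiffOn_levelFun : ContDiffOn ℝ ∞ (levelFun k) V.band := V.chart.2.2.2.2.1

/-- The depth is smooth on the band. [folklore] -/
theorem contDiffOn_depth : ContDiffOn ℝ ∞ (depth k) V.band := V.contDiffOn_levelFun.sub contDiffOn_const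

/-- The depth is smooth at band points. [folklore] -/
theorem contDiffAt_depth {y : EuclideanSpace ℝ (Fin 4)} (hy : y ∈ V.band) : ContDiffAt ℝ ∞ (depth k) y :=
  V.contDiffOn_depth.contDiffAt (V.band_open.mem_nhds hy)

/-- The drop is smooth on the band. [folklore] -/
theorem contDiffOn_drop : ContDiffOn ℝ ∞ V.drop V.band := V.chart.2.2.2.2.2

/-- The drop is smooth at band points. [folklore] -/
theorem contDiffAt_drop {y : EuclideanSpace ℝ (Fin 4)} (hy : y ∈ V.band) : ContDiffAt ℝ ∞ V.drop y :=
  V.contDiffOn_drop.contDiffAt (V.band_open.mem_nhds hy)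

/-- The depth is continuous on the band. [folklore] -/
theorem continuousOn_depth : ContinuousOn (depth k) V.band := V.contDiffOn_depth.continuousOn

/-- **`D_k` along the flow-out of `M_k`**: `Φ(s, a) ∈ D_k ↔ s ≤ 0` (`a ∈ M_k`, `|s| < 2ε`). [folklore] -/
theorem Φ_mem_modelHandlebody_iff {a : EuclideanSpace ℝ (Fin 4)} (ha : a ∈ modelBoundary k) {s : ℝ} (hs : |s| < 2 * V.ε) :
    V.Φ (s, a) ∈ modelHandlebody k ↔ s ≤ 0 := by
  obtain ⟨hh, hG⟩ := V.clock a ha s hs.le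
  constructor
  · intro h; linarith [h.2]
  · intro h
    exact FriendsCarrierVk.mem_modelHandlebody_of_half_le (fun j => (hh j).le) (by rw [hG]; linarith)

/-- A band point lies in `D_k` iff its depth is `≤ 0`. [folklore] -/
theorem mem_modelHandlebody_iff_depth {y : EuclideanSpace ℝ (Fin 4)} (hy : y ∈ V.band) : y ∈ modelHandlebody k ↔ depth k y ≤ 0 := by
  conv_lhs => rw [← V.Φ_depth_drop hy]
  exact V.Φ_mem_modelHandlebody_iff (V.drop_mem hy) (V.abs_depth_lt hy)

/-- `M_k` lies in the band, at depth `0`. [folklore] -/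
theorem mem_band_of_mem {a : EuclideanSpace ℝ (Fin 4)} (ha : a ∈ modelBoundary k) : a ∈ V.band ∧ depth k a = 0 := by
  have h2 : (0 : ℝ) < 2 * V.ε := by linarith [V.ε_pos]
  have h := V.Φ_mem_band ha (s := 0) (by rw [abs_zero]; exact h2)
  have h' := V.depth_Φ ha (s := 0) (by rw [abs_zero]; exact h2)
  rw [V.Φ_zero] at h h'
  exact ⟨h, h'⟩

/-! ### The thin shells `Φ((0, s) × M_k)` -/

/-- `Φ(s', a)` lies in the shell of depth `s` iff `0 < s' < s` (`a ∈ M_k`, `|s'| < 2ε`). [folklore] -/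
theorem Φ_mem_shell_iff {a : EuclideanSpace ℝ (Fin 4)} (ha : a ∈ modelBoundary k) {s' : ℝ} (hs' : |s'| < 2 * V.ε) (s : ℝ) :
    V.Φ (s', a) ∈ V.shell s ↔ 0 < s' ∧ s' < s := by
  simp only [shell, mem_setOf_eq, V.depth_Φ ha hs', V.Φ_mem_band ha hs', true_and]

/-- A point of a shell is `Φ(s', a)` with `a ∈ M_k`, `0 < s' < s`. [folklore] -/
theorem exists_of_mem_shell {s : ℝ} {y : EuclideanSpace ℝ (Fin 4)} (hy : y ∈ V.shell s) :
    ∃ a ∈ modelBoundary k, ∃ s' : ℝ, 0 < s' ∧ s' < s ∧ |s'| < 2 * V.ε ∧ V.Φ (s', a) = y :=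
  ⟨V.drop y, V.drop_mem hy.1, depth k y, hy.2.1, hy.2.2, V.abs_depth_lt hy.1, V.Φ_depth_drop hy.1⟩

/-- Shells are monotone in the depth. [folklore] -/
theorem shell_mono {s t : ℝ} (h : s ≤ t) : V.shell s ⊆ V.shell t := fun _ hy => ⟨hy.1, hy.2.1, hy.2.2.trans_le h⟩

/-- Shells are open. [folklore] -/
theorem isOpen_shell (s : ℝ) : IsOpen (V.shell s) :=
  V.continuousOn_depth.isOpen_inter_preimage V.band_open isOpen_Ioo

/-- Shells miss `D_k`. [folklore] -/
theorem not_mem_modelHandlebody_of_mem_shell {s : ℝ} {y : EuclideanSpace ℝ (Fin 4)} (hy : y ∈ V.shell s) : y ∉ modelHandlebody k :=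
  fun h => absurd ((V.mem_modelHandlebody_iff_depth hy.1).1 h) (not_le.2 hy.2.1)

/-- Shells lie in the compact sets `Φ([0, s] × M_k)`. [folklore] -/
theorem shell_subset_image (s : ℝ) : V.shell s ⊆ V.Φ '' (Icc 0 s ×ˢ modelBoundary k) := fun y hy =>
  ⟨(depth k y, V.drop y), ⟨⟨hy.2.1.le, hy.2.2.le⟩, V.drop_mem hy.1⟩, V.Φ_depth_drop hy.1⟩

/-- `Φ([0, s] × M_k)` is compact. [folklore] -/
theorem isCompact_image_Icc (s : ℝ) : IsCompact (V.Φ '' (Icc 0 s ×ˢ modelBoundary k)) :=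
  (isCompact_Icc.prod isCompact_modelBoundary).image V.continuous_Φ

/-- A point of `Φ([0, s] × M_k)` off `D_k` lies in the shell of depth `t` for `s < t`, `s < 2ε`. [folklore] -/
theorem mem_shell_of_mem_image {s t : ℝ} (hst : s < t) (hs : s < 2 * V.ε) {y : EuclideanSpace ℝ (Fin 4)}
    (hy : y ∈ V.Φ '' (Icc 0 s ×ˢ modelBoundary k)) (hyD : y ∉ modelHandlebody k) : y ∈ V.shell t := by
  obtain ⟨⟨s', a⟩, ⟨⟨h0, h1⟩, ha⟩, rfl⟩ := hy
  have hs' : |s'| < 2 * V.ε := by rw [abs_of_nonneg h0]; linarith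
  have hpos : 0 < s' := by
    by_contra h
    exact hyD ((V.Φ_mem_modelHandlebody_iff ha hs').2 (not_lt.1 h))
  exact (V.Φ_mem_shell_iff ha hs' t).2 ⟨hpos, by linarith⟩


/-! ### The tube neighbourhood of the open disc and its inverse chart -/

/-- `G` is smooth at every point of its domain `D̊² × B(0,2)` (`ConicalDiscTube.dom`). [folklore] -/
theorem contDiffAt_G {q : (EuclideanSpace ℝ (Fin 2)) × (EuclideanSpace ℝ (Fin 2))} (hq : q ∈ (ConicalDiscTube.dom : Set ((EuclideanSpace ℝ (Fin 2)) × (EuclideanSpace ℝ (Fin 2))))) : ContDiffAt ℝ ∞ V.G q :=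
  V.contDiffOn.contDiffAt (ConicalDiscTube.isOpen_dom.mem_nhds hq)

/-- The derivative of `G` at a point of the domain is a linear equivalence (injective, equal dimensions). [folklore] -/
theorem exists_fderiv_eq_equiv {q : (EuclideanSpace ℝ (Fin 2)) × (EuclideanSpace ℝ (Fin 2))} (hq : q ∈ (ConicalDiscTube.dom : Set ((EuclideanSpace ℝ (Fin 2)) × (EuclideanSpace ℝ (Fin 2))))) :
    ∃ L : ((EuclideanSpace ℝ (Fin 2)) × (EuclideanSpace ℝ (Fin 2))) ≃L[ℝ] (EuclideanSpace ℝ (Fin 4)), (L : ((EuclideanSpace ℝ (Fin 2)) × (EuclideanSpace ℝ (Fin 2))) →L[ℝ] (EuclideanSpace ℝ (Fin 4))) = fderiv ℝ V.G q :=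
  ⟨(LinearEquiv.ofBijective (fderiv ℝ V.G q).toLinearMap
    ⟨V.injective_fderiv q hq, (LinearMap.injective_iff_surjective_of_finrank_eq_finrank (by simp)).1
      (V.injective_fderiv q hq)⟩).toContinuousLinearEquiv, ContinuousLinearMap.ext fun _ => rfl⟩

/-- `G` has an invertible strict derivative at every point of its domain. [folklore] -/
theorem exists_hasStrictFDerivAt_G {q : (EuclideanSpace ℝ (Fin 2)) × (EuclideanSpace ℝ (Fin 2))} (hq : q ∈ (ConicalDiscTube.dom : Set ((EuclideanSpace ℝ (Fin 2)) × (EuclideanSpace ℝ (Fin 2))))) :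
    ∃ L : ((EuclideanSpace ℝ (Fin 2)) × (EuclideanSpace ℝ (Fin 2))) ≃L[ℝ] (EuclideanSpace ℝ (Fin 4)), HasStrictFDerivAt V.G (L : ((EuclideanSpace ℝ (Fin 2)) × (EuclideanSpace ℝ (Fin 2))) →L[ℝ] (EuclideanSpace ℝ (Fin 4))) q := by
  obtain ⟨L, hL⟩ := V.exists_fderiv_eq_equiv hq
  exact ⟨L, by rw [hL]; exact (V.contDiffAt_G hq).hasStrictFDerivAt (by simp)⟩

/-- **`G` maps open subsets of its domain to open sets** (inverse function theorem). [folklore] -/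
theorem isOpen_image {U : Set ((EuclideanSpace ℝ (Fin 2)) × (EuclideanSpace ℝ (Fin 2)))} (hU : IsOpen U) (hUd : U ⊆ ConicalDiscTube.dom) : IsOpen (V.G '' U) := by
  rw [isOpen_iff_mem_nhds]
  rintro _ ⟨q, hq, rfl⟩
  obtain ⟨L, hL⟩ := V.exists_hasStrictFDerivAt_G (hUd hq)
  rw [← hL.map_nhds_eq_of_equiv]
  exact Filter.image_mem_map (hU.mem_nhds hq)

/-- The tube neighbourhood is open. [folklore] -/
theorem isOpen_N : IsOpen V.N := V.isOpen_image ConicalDiscTube.isOpen_dom Subset.rfl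

/-- `Ginv (G q) = q` on the domain. [folklore] -/
theorem Ginv_apply {q : (EuclideanSpace ℝ (Fin 2)) × (EuclideanSpace ℝ (Fin 2))} (hq : q ∈ (ConicalDiscTube.dom : Set ((EuclideanSpace ℝ (Fin 2)) × (EuclideanSpace ℝ (Fin 2))))) : V.Ginv (V.G q) = q :=
  V.injOn.leftInvOn_invFunOn hq

/-- `Ginv` maps the tube neighbourhood into the domain. [folklore] -/
theorem Ginv_mem {z : EuclideanSpace ℝ (Fin 4)} (hz : z ∈ V.N) : V.Ginv z ∈ (ConicalDiscTube.dom : Set ((EuclideanSpace ℝ (Fin 2)) × (EuclideanSpace ℝ (Fin 2)))) :=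
  Function.invFunOn_mem (f := V.G) hz

/-- `G (Ginv z) = z` on the tube neighbourhood. [folklore] -/
theorem G_Ginv {z : EuclideanSpace ℝ (Fin 4)} (hz : z ∈ V.N) : V.G (V.Ginv z) = z :=
  Function.invFunOn_eq (f := V.G) hz

/-- **The inverse of the disc tube is smooth on `N`.** [folklore] -/
theorem contDiffAt_Ginv {z : EuclideanSpace ℝ (Fin 4)} (hz : z ∈ V.N) : ContDiffAt ℝ ∞ V.Ginv z := by
  set q := V.Ginv z with hqdef
  have hq : q ∈ (ConicalDiscTube.dom : Set ((EuclideanSpace ℝ (Fin 2)) × (EuclideanSpace ℝ (Fin 2)))) := V.Ginv_mem hz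
  have hGq : V.G q = z := V.G_Ginv hz
  have hcd : ContDiffAt ℝ ∞ V.G q := V.contDiffAt_G hq
  obtain ⟨L, hL⟩ := V.exists_hasStrictFDerivAt_G hq
  have hder : HasFDerivAt V.G (L : ((EuclideanSpace ℝ (Fin 2)) × (EuclideanSpace ℝ (Fin 2))) →L[ℝ] (EuclideanSpace ℝ (Fin 4))) q := hL.hasFDerivAt
  have hn : (∞ : ℕ∞ω) ≠ 0 := by simp
  have hstrict := hcd.hasStrictFDerivAt' hder hn
  have hleft : ∀ᶠ x in 𝓝 q, V.Ginv (V.G x) = x := by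
    filter_upwards [ConicalDiscTube.isOpen_dom.mem_nhds hq] with x hx
    exact V.Ginv_apply hx
  have huniq := HasStrictFDerivAt.localInverse_unique hstrict hleft
  have hloc : ContDiffAt ℝ ∞ (hcd.localInverse hder hn) (V.G q) := hcd.to_localInverse hder hn
  rw [hGq] at huniq hloc
  exact hloc.congr_of_eventuallyEq huniq

/-- `Ginv` is `C^∞` on the tube neighbourhood. [folklore] -/
theorem contDiffOn_Ginv : ContDiffOn ℝ ∞ V.Ginv V.N := fun _ hz => (V.contDiffAt_Ginv hz).contDiffWithinAt

/-- The tube neighbourhood misses `D_k`. [folklore] -/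
theorem not_mem_modelHandlebody_of_mem_N {z : EuclideanSpace ℝ (Fin 4)} (hz : z ∈ V.N) : z ∉ modelHandlebody k := by
  obtain ⟨q, hq, rfl⟩ := hz; exact V.not_mem q hq

/-! ### The tube of the knot and the closed unit tube -/

/-- `ν (u, w)` lies on the knot iff `w = 0`. [folklore] -/
theorem ν_mem_range_iff {u : (Metric.sphere (0 : EuclideanSpace ℝ (Fin 2)) 1)} {w : EuclideanSpace ℝ (Fin 2)} : V.ν (u, w) ∈ range V.K₁ ↔ w = 0 := by
  constructor
  · rintro ⟨u', h⟩
    rw [← V.ν_zero] at h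
    exact (Prod.ext_iff.1 (V.injective_ν h)).2.symm
  · rintro rfl; exact ⟨u, (V.ν_zero u).symm⟩

/-- `ν (u, τ v) ∉ K₁(𝕊¹)` for `τ ≠ 0`. [folklore] -/
theorem ν_smul_not_mem_range {τ : ℝ} (hτ : τ ≠ 0) (u v : (Metric.sphere (0 : EuclideanSpace ℝ (Fin 2)) 1)) : V.ν (u, τ • (v : EuclideanSpace ℝ (Fin 2))) ∉ range V.K₁ := by
  rw [V.ν_mem_range_iff]; exact smul_ne_zero hτ (ne_zero_of_mem_unit_sphere v)

/-- The tube is continuous. [folklore] -/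
theorem continuous_ν : Continuous V.ν := V.contMDiff_ν.continuous

/-- `ι (ν q) = q`: the tube coordinates of a tube point. [folklore] -/
theorem ι_ν (q : (Metric.sphere (0 : EuclideanSpace ℝ (Fin 2)) 1) × (EuclideanSpace ℝ (Fin 2))) : V.ι (V.ν q) = q := by
  have h := V.ι_Φ q 0 ⟨by linarith [V.ε_pos], by linarith [V.ε_pos]⟩
  rwa [V.Φ_zero] at h

/-- A point of `M_k` lies in the flow-out tube of `ν` iff it lies in the open tube `ν(𝕊¹ × ℝ²)`. [folklore] -/
theorem mem_flowTube_iff_of_mem {a : EuclideanSpace ℝ (Fin 4)} (ha : a ∈ modelBoundary k) :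
    a ∈ {y : EuclideanSpace ℝ (Fin 4) | (∀ j, (1 : ℝ) / 2 < holeTerm k j y) ∧ levelFun k y ∈ Ioo (1 - 2 * V.ε) (1 + 2 * V.ε) ∧
      V.Φ (1 - levelFun k y, y) ∈ range V.ν} ↔ a ∈ range V.ν := by
  have hg : ∀ j, (1 : ℝ) / 2 < holeTerm k j a := fun j => lt_of_lt_of_le (by norm_num) (ha.1 j)
  have h1 : V.Φ (1 - levelFun k a, a) = a := by rw [ha.2, sub_self, V.Φ_zero]
  constructor
  · rintro ⟨-, -, h⟩; rwa [h1] at h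
  · intro h
    exact ⟨hg, by rw [ha.2]; exact ⟨by linarith [V.ε_pos], by linarith [V.ε_pos]⟩, by rwa [h1]⟩

/-- `ν (u, w)` lies in the closed unit tube iff `‖w‖ ≤ 1`. [folklore] -/
theorem mem_unitTube_iff {u : (Metric.sphere (0 : EuclideanSpace ℝ (Fin 2)) 1)} {w : EuclideanSpace ℝ (Fin 2)} : V.ν (u, w) ∈ V.unitTube ↔ ‖w‖ ≤ 1 := by
  rw [unitTube, V.injective_ν.mem_set_image]; simp

/-- The knot lies in the closed unit tube. [folklore] -/
theorem range_subset_unitTube : range V.K₁ ⊆ V.unitTube := by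
  rintro _ ⟨u, rfl⟩; rw [← V.ν_zero, mem_unitTube_iff]; simp

/-- The closed unit tube is compact. [folklore] -/
theorem isCompact_unitTube : IsCompact V.unitTube :=
  (isCompact_univ.prod (isCompact_closedBall _ _)).image V.continuous_ν

/-- The closed unit tube is closed. [folklore] -/
theorem isClosed_unitTube : IsClosed V.unitTube := V.isCompact_unitTube.isClosed

/-- The closed unit tube lies in `M_k`. [folklore] -/
theorem unitTube_subset : V.unitTube ⊆ modelBoundary k := by
  rintro _ ⟨q, -, rfl⟩; exact V.ν_mem q

/-! ### The disc -/

/-- The disc is compact. [folklore] -/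
theorem isCompact_disc : IsCompact V.disc :=
  (isCompact_closedBall _ _).image V.isModelSliceDisc.1.continuous

/-- The disc is closed. [folklore] -/
theorem isClosed_disc : IsClosed V.disc := V.isCompact_disc.isClosed

/-- The boundary circle goes to the knot: `g x = K₁ x̂ ∈ M_k` for `‖x‖ = 1`. [folklore] -/
theorem g_eq_of_norm_eq_one {x : EuclideanSpace ℝ (Fin 2)} (hx : ‖x‖ = 1) : V.g x = V.K₁ (radialProjection (spherePt 1) x) := by
  have hxe : ((radialProjection (spherePt 1) x : (Metric.sphere (0 : EuclideanSpace ℝ (Fin 2)) 1)) : EuclideanSpace ℝ (Fin 2)) = x := by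
    have := norm_smul_coe_radialProjection (spherePt 1) x
    rwa [hx, one_smul] at this
  have := V.g_cone (radialProjection (spherePt 1) x) 1 (by linarith [V.width_pos]) le_rfl
  rwa [one_smul, sub_self, V.Φ_zero, hxe] at this

/-- A boundary point of the disc lies in `D_k`. [folklore] -/
theorem g_mem_modelHandlebody_of_norm_eq_one {x : EuclideanSpace ℝ (Fin 2)} (hx : ‖x‖ = 1) : V.g x ∈ modelHandlebody k := by
  rw [V.g_eq_of_norm_eq_one hx]; exact modelBoundary_subset_modelHandlebody (V.isModelKnot.mem _)

/-- The zero section of the tube is the disc. [folklore] -/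
theorem G_zero_mem_disc {x : EuclideanSpace ℝ (Fin 2)} (hx : ‖x‖ < 1) : V.G (x, 0) ∈ V.disc :=
  ⟨x, by simpa using hx.le, (V.apply_zero x (by simpa using hx)).symm⟩

/-- A tube point off the zero section is off the disc. [folklore] -/
theorem G_not_mem_disc {x w : EuclideanSpace ℝ (Fin 2)} (hx : ‖x‖ < 1) (hw : ‖w‖ < 2) (hw0 : w ≠ 0) : V.G (x, w) ∉ V.disc := by
  intro hmem
  obtain ⟨x', hx', h⟩ : ∃ x' ∈ closedBall (0 : EuclideanSpace ℝ (Fin 2)) 1, V.g x' = V.G (x, w) := hmem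
  have hx'' : ‖x'‖ ≤ 1 := by rwa [mem_closedBall, dist_zero_right] at hx'
  have hq2 : ((x, w) : (EuclideanSpace ℝ (Fin 2)) × (EuclideanSpace ℝ (Fin 2))) ∈ (ConicalDiscTube.dom : Set ((EuclideanSpace ℝ (Fin 2)) × (EuclideanSpace ℝ (Fin 2)))) := ConicalDiscTube.mem_dom_iff.2 ⟨hx, hw⟩
  rcases hx''.lt_or_eq with hlt | heq
  · have h2 : V.G (x', 0) = V.G (x, w) := by rw [V.apply_zero x' (by simpa using hlt)]; exact h
    have hq1 : ((x', (0 : EuclideanSpace ℝ (Fin 2))) : (EuclideanSpace ℝ (Fin 2)) × (EuclideanSpace ℝ (Fin 2))) ∈ (ConicalDiscTube.dom : Set ((EuclideanSpace ℝ (Fin 2)) × (EuclideanSpace ℝ (Fin 2)))) :=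
      ConicalDiscTube.mem_dom_iff.2 ⟨hlt, by simp⟩
    have := V.injOn hq1 hq2 h2
    exact hw0 (congrArg Prod.snd this).symm
  · -- a boundary point of the disc lies in `D_k`, a tube point does not
    exact V.not_mem _ hq2 (h ▸ V.g_mem_modelHandlebody_of_norm_eq_one heq)


end CollarDatum

end FriendsVk

/-- **Helper `helper_friendsCarrier_Vk_partC_tube`** (registered piece 2 of `helper_friendsCarrier_Vk_partC`,
line `mk_friends`, crux `DcrGap`): under the hypotheses of part C (flow, disc, tubes), the tube neighbourhood
`N = G(D̊² × B(0,2))` of the open disc is OPEN in `ℝ⁴`, misses `D_k`, and the inverse of `G` is `C^∞` on it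
(inverse function theorem); and the thin shell `Φ((0, s₀) × M_k)` is open and misses `D_k`
(Kosinski 1993, Ch. VI §5). [cite: Kosinski1993, Ch. VI §5] -/
theorem helper_friendsCarrier_Vk_partC_tube : ∀ (k : ℕ) (K₁ : (sphere (0 : EuclideanSpace ℝ (Fin 2)) 1) → EuclideanSpace ℝ (Fin 4)) (Φ : ℝ × EuclideanSpace ℝ (Fin 4) → EuclideanSpace ℝ (Fin 4)) (ε s₁ s₀ : ℝ) (g : EuclideanSpace ℝ (Fin 2) → EuclideanSpace ℝ (Fin 4)) (G : EuclideanSpace ℝ (Fin 2) × EuclideanSpace ℝ (Fin 2) → EuclideanSpace ℝ (Fin 4)) (ν : (sphere (0 : EuclideanSpace ℝ (Fin 2)) 1) × EuclideanSpace ℝ (Fin 2) → EuclideanSpace ℝ (Fin 4)), IsModelKnot k K₁ → ContDiff ℝ ∞ Φ → (∀ x, Φ (0, x) = x) → (∀ s t x, Φ (s, Φ (t, x)) = Φ (s + t, x)) → 0 < ε → ε ≤ 1 / 4 → (∀ x ∈ modelBoundary k, ∀ s : ℝ, |s| ≤ 2 * ε → (∀ j, (1 : ℝ) / 2 < holeTerm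 k j (Φ (s, x))) ∧ levelFun k (Φ (s, x)) = 1 + s) → (∀ y, (∀ j, 0 < holeTerm k j y) → |levelFun k y - 1| < 2 * ε → Φ (1 - levelFun k y, y) ∈ modelBoundary k) → 0 < s₀ → s₀ < s₁ → s₁ < 2 * ε → IsModelSliceDisc k K₁ g → (∀ (u : (sphere (0 : EuclideanSpace ℝ (Fin 2)) 1)) (t : ℝ), 1 - s₁ ≤ t → t ≤ 1 → g (t • (u : EuclideanSpace ℝ (Fin 2))) = Φ (1 - t, K₁ u)) → (ContDiffOn ℝ ∞ G (ball 0 1 ×ˢ ball 0 2) ∧ InjOn G (ball 0 1 ×ˢ ball 0 2) ∧ (∀ q ∈ ball 0 1 ×ˢ ball 0 2, Injective (fderiv ℝ G q)) ∧ (∀ q ∈ ball 0 1 ×ˢ ball 0 2, G q ∉ modelHandlebody k) ∧ (∀ x ∈ ball 0 1, G (x, 0) = g x)) → (∀ (u : (sphere (0 : EuclideanSpace ℝ (Fin 2)) 1)) (t : ℝ) (w : EuclideanSpace ℝ (Fin 2)), 1 - s₁ < t → t < 1 → ‖w‖ < 2 → G (t • (u : EuclideanSpace ℝ (Fin 2)),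 w) = Φ (1 - t, ν (u, w))) → (∀ (x w : EuclideanSpace ℝ (Fin 2)), ‖x‖ ≤ 1 - s₀ → ‖w‖ < 2 → ∀ a ∈ modelBoundary k, ∀ s : ℝ, 0 < s → s < s₀ → G (x, w) ≠ Φ (s, a)) → ContMDiff ((𝓡 1).prod 𝓘(ℝ, EuclideanSpace ℝ (Fin 2))) 𝓘(ℝ, EuclideanSpace ℝ (Fin 4)) ∞ ν → Injective ν → (∀ p, Injective (mfderiv ((𝓡 1).prod 𝓘(ℝ, EuclideanSpace ℝ (Fin 2))) 𝓘(ℝ, EuclideanSpace ℝ (Fin 4)) ν p)) → (∀ p, ν p ∈ modelBoundary k) → (∀ u : (sphere (0 : EuclideanSpace ℝ (Fin 2)) 1), ν (u, 0) = K₁ u) → (IsOpen (G '' (ball 0 1 ×ˢ ball 0 2)) ∧ (∀ z ∈ G '' (ball 0 1 ×ˢ ball 0 2), z ∉ modelHandlebody k) ∧ ContDiffOn ℝ ∞ (Function.invFunOn G (ball 0 1 ×ˢ ball 0 2)) (G '' (ball 0 1 ×ˢ ball 0 2))) ∧ IsOpen {y : EuclideanSpace ℝ (Fin 4) | ((∀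 j : Fin k, 0 < holeTerm k j y) ∧ |levelFun k y - 1| < 2 * ε) ∧ 0 < levelFun k y - 1 ∧ levelFun k y - 1 < s₀} ∧ (∀ y : EuclideanSpace ℝ (Fin 4), ((∀ j : Fin k, 0 < holeTerm k j y) ∧ |levelFun k y - 1| < 2 * ε) ∧ 0 < levelFun k y - 1 ∧ levelFun k y - 1 < s₀ → y ∉ modelHandlebody k) := by
  intro k K₁ Φ ε s₁ s₀ g G ν hK hΦ hΦ0 hΦadd hε hε4 hclock hband hs₀ hs₀₁ hs₁ε hg hgcone hG hGcone hdeep h3 h4 h5 h6 h7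
  let V : FriendsVk.CollarDatum k :=
    FriendsVk.CollarDatum.datumOf hK hΦ hΦ0 hΦadd hε hε4 hclock hband hs₀ hs₀₁ hs₁ε hg hgcone hG hGcone hdeep h3 h4 h5 h6 h7
  exact ⟨⟨V.isOpen_N, fun z hz => V.not_mem_modelHandlebody_of_mem_N hz, V.contDiffOn_Ginv⟩, V.isOpen_shell V.s₀,
    fun y hy => V.not_mem_modelHandlebody_of_mem_shell hy⟩

end Summit.SmoothPoincare4.SmoothPoincare4.Theorems.DcrGap.MkFriends

end
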